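import Summits.ValiantsHypothesis.ValiantsHypothesis.Theorems.MonotoneRestorationOrbitRestorationLinearVolumeQPHalfDegreeTight
import Summits.ValiantsHypothesis.ValiantsHypothesis.Theorems.MonotoneRestorationOrbitRestorationLinearVolumeQPNarrowSpanToDiNarrow
import Summits.ValiantsHypothesis.ValiantsHypothesis.Theorems.MonotoneRestorationMonotoneRestorationQPZetaPatterns
import HarnessLib

/-!
# Route MonotoneRestoration — aside `OrbitCompressionQP` (stmt-ValiantsHypothesis-18332), line
# `expression_compression`: THE REPAIRED FIRST STUB HOLDS BELOW THE INJECTIVE THRESHOLD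

The registered first stub `stub_orbitToNarrowExpression` (square-symmetric circuits of quasi-polynomial ORBIT
size ⇒ closed BIPARTITE labelled pattern expressions with `n^{k+l} ≤ 2^{(log₂ n + c)^c}` labels) is false as
registered (the trace, `Theorems/…OrbitToNarrowExpressionFalse.lean`); its repair adds the matrix symmetry
that the aside itself carries.  The repaired stub splits into the one-sorted extraction (PROVED:
`OrbitSupport.qpOrbitFamily_iff_diNarrow`) and the one-sorted → two-sorted passage S1c, open above the
injective threshold `deg f_n > n/2`.  This file records that BELOW the threshold nothing is open:

* `exists_close_eq_of_qpOrbit_halfDegree` — a matrix-symmetric family with square-symmetric circuits of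
  quasi-polynomial orbit size is, for one constant `c` and on EVERY level `n ≥ 1` with `2 · deg f_n ≤ n`, the
  closed polynomial of a bipartite labelled pattern expression with `(log₂ n + c)^c` row and column labels
  (orbit support ⟹ one-sorted expressions ⟹ one-sorted narrow span by unfolding ⟹ bipartite narrow span
  by sub-threshold descent — `OrbitRestorationLinearVolumeQPHalfDegree.narrowSpan_halfDegree_of_diNarrow` —
  ⟹ one closed expression by K2 and linearity of `close`);
* `orbitToNarrowExpression_halfDegree` — the same in the registered stub's literal currency
  `∃ k l (e : PatternExpr ℂ k l), n^{k+l} ≤ 2^{(log₂ n + c)^c} ∧ e.close n = f n`, level by level;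
* `orbitToNarrowExpression_of_halfDegree` — **THE REPAIRED STUB 1, VERBATIM CONCLUSION, for every
  matrix-symmetric family all of whose levels satisfy `2 · deg f_n ≤ n`** (VH-free, `VP`-free);
* `qpOrbit_iff_narrowExpression_of_halfDegree` — on that class, quasi-polynomial ORBITS and NARROW
  BIPARTITE EXPRESSIONS are EQUIVALENT (the converse is `NarrowToOrbit.qpOrbit_of_narrowExpression'`);
* `orbitCompressionQP_halfDegree_of_stub2` — **the registered line is INTACT on the half-degree class**: the
  registered second stub `stub_narrowExpressionCompression` ALONE (taken verbatim as a hypothesis) gives the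
  aside's conclusion (square-symmetric circuits of quasi-polynomial SIZE) for every matrix-symmetric `VP`
  family with `2 · deg f_n ≤ n` on all levels, through THEOREM ζ-P (`qpSymmetric_patternExpr`).

Honest label: composition of landed theorems; the repaired first stub above the threshold (S1c for
`deg f_n > n/2`), the second stub, the aside and VP ≠ VNP are NOT moved.  Helper file
(`--supports stmt-ValiantsHypothesis-18332`); def-free; nothing here is a named fact.

References: Dawar–Pago–Seppelt 2025 (arXiv:2502.06740) Thm 1.1, Remark p. 17, §7 p. 45; Dwivedi–Pago–Seppelt
2026 (arXiv:2601.09343) Lemma 8.18, Outlook Q3; Dawar–Wilsenach 2025 §6.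
-/

noncomputable section

open scoped Classical

-- `Summit.ValiantsHypothesis.ValiantsHypothesis.…` is the tree's single-conjunct layout (Sub = Summit).
set_option linter.dupNamespace false

namespace Summit.ValiantsHypothesis.ValiantsHypothesis.Theorems

namespace OrbitToNarrowHalfDegree

open Literature.Computability.AlgebraicComplexity MvPolynomial
open Summit.ValiantsHypothesis.ValiantsHypothesis.Theorems.OrbitRestorationQPHomPolyClose
open Summit.ValiantsHypothesis.ValiantsHypothesis.Theorems.OrbitRestorationLinearVolumeQPHalfDegree

/-! ### The repaired first stub on half-degree levels -/

/-- **Quasi-polynomial orbits ⟹ ONE closed bipartite expression with polylog labels, on every half-degree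
level** of a matrix-symmetric family (`n ≥ 1`, `2 · deg f_n ≤ n`; `(log₂ n + c)^c` row and column labels).
[cite: DawarPagoSeppelt2025, Theorem 1.1 and §7 (p. 45)] -/
theorem exists_close_eq_of_qpOrbit_halfDegree (f : (n : ℕ) → MvPolynomial (Fin n × Fin n) ℂ)
    (hsymm : ∀ (n : ℕ) (σ τ : Equiv.Perm (Fin n)),
      rename (fun ij : Fin n × Fin n => (σ ij.1, τ ij.2)) (f n) = f n)
    (horb : ∃ c : ℕ, ∀ n : ℕ, ∃ (G : Type) (_ : Fintype G)
        (C : LabelledArithCircuit ℂ (Fin n × Fin n) Unit G),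
      C.IsSymmetric (Equiv.Perm (Fin n)) ∧ C.eval (C.output ()) = f n ∧
      C.orbitSize (Equiv.Perm (Fin n)) ≤ 2 ^ ((Nat.log 2 n + c) ^ c)) :
    ∃ c : ℕ, ∀ n : ℕ, 1 ≤ n → 2 * (f n).totalDegree ≤ n →
      ∃ e : PatternExpr ℂ ((Nat.log 2 n + c) ^ c) ((Nat.log 2 n + c) ^ c), e.close n = f n := by
  obtain ⟨c, hc⟩ := narrowSpan_halfDegree_of_diNarrow f hsymm
    ((OrbitSupport.qpOrbitFamily_iff_diNarrow f).1 horb).2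
  exact ⟨c + 2, fun n hn hdeg =>
    narrowExpression_of_mem_narrowSpan stub_homPoly_close n c hn (f n) (hc n hdeg)⟩

/-- **The repaired first stub, level by level below the injective threshold, in the registered currency**:
for one constant `c` and every level `n ≥ 1` with `2 · deg f_n ≤ n`, `f n = e.close n` for a bipartite
labelled pattern expression `e` with `k + l` labels, `n^{k+l} ≤ 2^{(log₂ n + c)^c}`.
[cite: DawarPagoSeppelt2025, Theorem 1.1 and §7 (p. 45)] -/
theorem orbitToNarrowExpression_halfDegree (f : (n : ℕ) → MvPolynomial (Fin n × Fin n) ℂ)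
    (hsymm : ∀ (n : ℕ) (σ τ : Equiv.Perm (Fin n)),
      rename (fun ij : Fin n × Fin n => (σ ij.1, τ ij.2)) (f n) = f n)
    (horb : ∃ c : ℕ, ∀ n : ℕ, ∃ (G : Type) (_ : Fintype G)
        (C : LabelledArithCircuit ℂ (Fin n × Fin n) Unit G),
      C.IsSymmetric (Equiv.Perm (Fin n)) ∧ C.eval (C.output ()) = f n ∧
      C.orbitSize (Equiv.Perm (Fin n)) ≤ 2 ^ ((Nat.log 2 n + c) ^ c)) :
    ∃ c : ℕ, ∀ n : ℕ, 1 ≤ n → 2 * (f n).totalDegree ≤ n →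
      ∃ (k l : ℕ) (e : PatternExpr ℂ k l),
        n ^ (k + l) ≤ 2 ^ ((Nat.log 2 n + c) ^ c) ∧ e.close n = f n := by
  obtain ⟨c, hc⟩ := narrowSpan_halfDegree_of_diNarrow f hsymm
    ((OrbitSupport.qpOrbitFamily_iff_diNarrow f).1 horb).2
  refine ⟨c + 5, fun n hn hdeg => ?_⟩
  obtain ⟨e, he⟩ := narrowExpression_of_mem_narrowSpan stub_homPoly_close n c hn (f n) (hc n hdeg)
  exact ⟨_, _, e, OrbitRestorationLinearVolumeQPDiNarrow.pow_twice_polylog_le_qp n c, he⟩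

/-- **THE REPAIRED STUB 1 ON THE HALF-DEGREE CLASS (verbatim conclusion of the registered
`stub_orbitToNarrowExpression`).**  A MATRIX-symmetric family with `2 · deg f_n ≤ n` on every level that has
square-symmetric circuits of quasi-polynomial orbit size is, for one constant `c` and every `n ≥ 1`, the
closed polynomial of a bipartite labelled pattern expression with `n^{k+l} ≤ 2^{(log₂ n + c)^c}`.  VH-free,
`VP`-free. [cite: DawarPagoSeppelt2025, Theorem 1.1 and §7 (p. 45)] -/
theorem orbitToNarrowExpression_of_halfDegree (f : (n : ℕ) → MvPolynomial (Fin n × Fin n) ℂ)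
    (hsymm : ∀ (n : ℕ) (σ τ : Equiv.Perm (Fin n)),
      rename (fun ij : Fin n × Fin n => (σ ij.1, τ ij.2)) (f n) = f n)
    (hdeg : ∀ n : ℕ, 2 * (f n).totalDegree ≤ n)
    (horb : ∃ c : ℕ, ∀ n : ℕ, ∃ (G : Type) (_ : Fintype G)
        (C : LabelledArithCircuit ℂ (Fin n × Fin n) Unit G),
      C.IsSymmetric (Equiv.Perm (Fin n)) ∧ C.eval (C.output ()) = f n ∧
      C.orbitSize (Equiv.Perm (Fin n)) ≤ 2 ^ ((Nat.log 2 n + c) ^ c)) :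
    ∃ c : ℕ, ∀ n : ℕ, 1 ≤ n → ∃ (k l : ℕ) (e : PatternExpr ℂ k l),
      n ^ (k + l) ≤ 2 ^ ((Nat.log 2 n + c) ^ c) ∧ e.close n = f n := by
  obtain ⟨c, hc⟩ := orbitToNarrowExpression_halfDegree f hsymm horb
  exact ⟨c, fun n hn => hc n hn (hdeg n)⟩

/-- **On the half-degree class of matrix-symmetric families, quasi-polynomial ORBITS ⟺ NARROW BIPARTITE
EXPRESSIONS.** [cite: DawarPagoSeppelt2025, Theorem 1.1 and §7 (p. 45)] -/
theorem qpOrbit_iff_narrowExpression_of_halfDegree (f : (n : ℕ) → MvPolynomial (Fin n × Fin n) ℂ)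
    (hsymm : ∀ (n : ℕ) (σ τ : Equiv.Perm (Fin n)),
      rename (fun ij : Fin n × Fin n => (σ ij.1, τ ij.2)) (f n) = f n)
    (hdeg : ∀ n : ℕ, 2 * (f n).totalDegree ≤ n) :
    (∃ c : ℕ, ∀ n : ℕ, ∃ (G : Type) (_ : Fintype G)
        (C : LabelledArithCircuit ℂ (Fin n × Fin n) Unit G),
      C.IsSymmetric (Equiv.Perm (Fin n)) ∧ C.eval (C.output ()) = f n ∧
      C.orbitSize (Equiv.Perm (Fin n)) ≤ 2 ^ ((Nat.log 2 n + c) ^ c)) ↔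
    (∃ c : ℕ, ∀ n : ℕ, 1 ≤ n → ∃ (k l : ℕ) (e : PatternExpr ℂ k l),
      n ^ (k + l) ≤ 2 ^ ((Nat.log 2 n + c) ^ c) ∧ e.close n = f n) :=
  ⟨orbitToNarrowExpression_of_halfDegree f hsymm hdeg, NarrowToOrbit.qpOrbit_of_narrowExpression' f⟩

/-! ### The registered line is intact on the half-degree class -/

/-- **THE LINE `expression_compression` CLOSES THE HALF-DEGREE SUB-ASIDE MODULO ITS SECOND STUB ALONE.**  If
the registered `stub_narrowExpressionCompression` holds (verbatim, as a hypothesis), then every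
MATRIX-symmetric `VP` family with `2 · deg f_n ≤ n` on all levels that has square-symmetric circuits of
quasi-polynomial ORBIT size has square-symmetric circuits of quasi-polynomial SIZE (repaired Stub 1 below the
threshold, this file; Stub 2; THEOREM ζ-P `qpSymmetric_patternExpr`).
[cite: DwivediPagoSeppelt2026, Outlook Q3] [cite: DawarPagoSeppelt2025, §5] -/
theorem orbitCompressionQP_halfDegree_of_stub2
    (stub2 : ∀ f : (n : ℕ) → MvPolynomial (Fin n × Fin n) ℂ,
      (∀ (n : ℕ) (σ τ : Equiv.Perm (Fin n)),
        MvPolynomial.rename (fun p : Fin n × Fin n => (σ p.1, τ p.2)) (f n) = f n) →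
      IsVPFamily f →
      (∃ c : ℕ, ∀ n : ℕ, 1 ≤ n → ∃ (k l : ℕ) (e : PatternExpr ℂ k l),
        n ^ (k + l) ≤ 2 ^ ((Nat.log 2 n + c) ^ c) ∧ e.close n = f n) →
      ∃ c : ℕ, ∀ n : ℕ, 1 ≤ n → ∃ (k l : ℕ) (e : PatternExpr ℂ k l),
        n ^ (k + l) ≤ 2 ^ ((Nat.log 2 n + c) ^ c) ∧ e.length ≤ 2 ^ ((Nat.log 2 n + c) ^ c) ∧
        e.close n = f n) :
    ∀ f : (n : ℕ) → MvPolynomial (Fin n × Fin n) ℂ,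
      (∀ (n : ℕ) (σ τ : Equiv.Perm (Fin n)),
        MvPolynomial.rename (fun p : Fin n × Fin n => (σ p.1, τ p.2)) (f n) = f n) →
      IsVPFamily f →
      (∀ n : ℕ, 2 * (f n).totalDegree ≤ n) →
      (∃ c : ℕ, ∀ n : ℕ, ∃ (G : Type) (_ : Fintype G)
          (C : LabelledArithCircuit ℂ (Fin n × Fin n) Unit G),
        C.IsSymmetric (Equiv.Perm (Fin n)) ∧ C.eval (C.output ()) = f n ∧
        C.orbitSize (Equiv.Perm (Fin n)) ≤ 2 ^ ((Nat.log 2 n + c) ^ c)) →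
      ∃ c : ℕ, ∀ n : ℕ, ∃ (G : Type) (_ : Fintype G)
          (C : LabelledArithCircuit ℂ (Fin n × Fin n) Unit G),
        C.IsSymmetric (Equiv.Perm (Fin n)) ∧ C.eval (C.output ()) = f n ∧
        Fintype.card G ≤ 2 ^ ((Nat.log 2 n + c) ^ c) :=
  fun f hsymm hVP hdeg horb =>
    qpSymmetric_patternExpr f (stub2 f hsymm hVP (orbitToNarrowExpression_of_halfDegree f hsymm hdeg horb))

end OrbitToNarrowHalfDegree

end Summit.ValiantsHypothesis.ValiantsHypothesis.Theorems

end
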